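import Literature.MathematicalPhysics.QuantumLattice.TraceInequalitiesProofs
import Literature.LinearAlgebra.Matrix.PosSemidefTrace
import Mathlib.Analysis.InnerProductSpace.GramMatrix

/-!
# Route BalabanIR — crux 4 `BirGappedPhaseReduction` (item `stmt-HubbardSuperconductivity-2082`): reflection positivity in TIME of projected traces with positive slice insertions

The repair of the engine/reduction pair (items 2080/2082) proposed by the crux-ideation of
`BirComplexStableXY` (ideator 3, `Cruxes/BirComplexStableXY/Ideas/ideator3-repairanalysis.md` §3)
and by the card `os-positive-phase-marginal` for this item is REFLECTION POSITIVITY IN TIME of the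
phase marginal: for ANY Hermitian `H`, any positive operator-valued slice insertions `K(θ) ≥ 0`
and the sector projection `P`, the `2m`-slice weight
`W(θ, θ') = Tr[P · B(θ₁)⋯B(θ_m) · B(θ'_m)⋯B(θ'₁)]`, `B(θ) = e^{-aH/2} K(θ) e^{-aH/2} ≥ 0`
(second half listed in time-REFLECTED order), is a positive-semidefinite kernel:
`Σ_{θ,θ'} g(θ) conj(g(θ')) W(θ,θ') = Tr[P Y Yᴴ] = ‖Yᴴ P‖²_HS ≥ 0`, `Y = Σ g(θ) B(θ₁)⋯B(θ_m)`.
Consequently the slice-transfer matrix `𝔹 = Σ_θ B(θ)` is positive, `Z_M = Tr[P 𝔹^M] ≥ 0`, and no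
Lee–Yang/Beraha–Kahane–Weiss zero can occur — the structural reason the restated engine escapes
the `M ≫ K L²` counterexamples recorded on item 2080. This file proves the finite-dimensional
algebra (sums over a finite family of half-space configurations; integrals follow by linearity):

* `posSemidef_trace_mul_mul_conjTranspose` — for `Q ≥ 0` and any family `Y : ι → Mat_n(ℂ)`, the
  kernel `(i, j) ↦ Tr[Q Y_i Y_jᴴ]` is positive semidefinite (a Gram matrix for the semi-inner
  product `⟪S, T⟫ = Tr(T Q Sᴴ)`, Mathlib's `Matrix.toMatrixInnerProductSpace`);
* `re_sum_sum_trace_mul_mul_conjTranspose_nonneg` — the scalar form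
  `0 ≤ Re Σ_{i,j} conj(g_i) g_j Tr[Q Y_i Y_jᴴ]` (and the sum is real);
* `conjTranspose_ofFn_prod_of_isHermitian` — for Hermitian slices the adjoint of the ordered
  product `B₁⋯B_m` is the time-reflected product `B_m⋯B₁`;
* `posSemidef_timeReflectedTrace` — hence `(i, j) ↦ Tr[Q · (B_{i,1}⋯B_{i,m}) · (B_{j,m}⋯B_{j,1})]`
  is positive semidefinite for Hermitian slice insertions `B_{i,τ}` and `Q ≥ 0`
  (e.g. `Q = P_S`, or `Q = P_S A P_S` with `A ≥ 0` an observable on the reflection plane);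
* `re_trace_mul_pow_nonneg_of_posSemidef`, `re_trace_mul_sum_pow_nonneg` — `Tr[Q 𝔹^M] ≥ 0` for
  `Q, 𝔹 ≥ 0` (from the tree's `Literature.LinearAlgebra.Matrix.re_trace_mul_nonneg_of_posSemidef`):
  projected partition functions of a positive transfer matrix are nonnegative.

Sources: K. Osterwalder, R. Schrader, Comm. Math. Phys. 31 (1973) 83 (reflection positivity);
J. Fröhlich, R. Israel, E. H. Lieb, B. Simon, Comm. Math. Phys. 62 (1978) 1, §2 (RP of traces);
folklore linear algebra (Gram matrices). No definition is introduced.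
-/

noncomputable section

open scoped ComplexOrder MatrixOrder

namespace Summit.HubbardSuperconductivity.HubbardSuperconductivity.Theorems

open Matrix Literature.MathematicalPhysics.QuantumLattice

variable {n : Type*} [Fintype n] [DecidableEq n] {ι : Type*} [Fintype ι]

/-! ### Gram positivity of `Tr[Q Y_i Y_jᴴ]` -/

omit [DecidableEq n] in
/-- **Gram positivity of weighted trace kernels.** For a positive semidefinite `Q` and any finite
family of square matrices `Y`, the kernel `(i, j) ↦ Tr[Q Y_i Y_jᴴ]` is a positive semidefinite
matrix: it is the Gram matrix of the family `(Y_iᴴ)` for the semi-inner product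
`⟪S, T⟫ = Tr(T Q Sᴴ)` (`Matrix.toMatrixInnerProductSpace Q`, `Matrix.posSemidef_gram`).
[folklore] -/
theorem posSemidef_trace_mul_mul_conjTranspose {Q : Matrix n n ℂ} (hQ : Q.PosSemidef)
    (Y : ι → Matrix n n ℂ) :
    (Matrix.of fun i j => (Q * Y i * (Y j)ᴴ).trace).PosSemidef := by
  letI : SeminormedAddCommGroup (Matrix n n ℂ) := Q.toMatrixSeminormedAddCommGroup hQ
  letI : InnerProductSpace ℂ (Matrix n n ℂ) := Q.toMatrixInnerProductSpace hQ
  have h := Matrix.posSemidef_gram ℂ (fun i => (Y i)ᴴ)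
  have hgram : Matrix.gram ℂ (fun i => (Y i)ᴴ) = Matrix.of fun i j => (Q * Y i * (Y j)ᴴ).trace := by
    ext i j
    rw [Matrix.gram_apply, Matrix.of_apply]
    show ((Y j)ᴴ * Q * (Y i)ᴴᴴ).trace = _
    rw [conjTranspose_conjTranspose, Matrix.mul_assoc, trace_mul_comm, Matrix.mul_assoc]
  rwa [hgram] at h

omit [DecidableEq n] in
/-- **Scalar form of Gram positivity**: for `Q ≥ 0`, matrices `Y_i` and coefficients `g_i`,
`Σ_{i,j} conj(g_i) g_j Tr[Q Y_i Y_jᴴ]` is a nonnegative real (`= Tr[Q T Tᴴ]`, `T = Σ conj(g_i) Y_i`).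
[folklore] -/
theorem sum_sum_trace_mul_mul_conjTranspose_nonneg {Q : Matrix n n ℂ} (hQ : Q.PosSemidef)
    (Y : ι → Matrix n n ℂ) (g : ι → ℂ) :
    0 ≤ ∑ i, ∑ j, (starRingEnd ℂ) (g i) * g j * (Q * Y i * (Y j)ᴴ).trace := by
  have h := (posSemidef_trace_mul_mul_conjTranspose hQ Y).dotProduct_mulVec_nonneg g
  have hsum : star g ⬝ᵥ (Matrix.of fun i j => (Q * Y i * (Y j)ᴴ).trace) *ᵥ g =
      ∑ i, ∑ j, (starRingEnd ℂ) (g i) * g j * (Q * Y i * (Y j)ᴴ).trace := by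
    simp only [dotProduct, mulVec, Matrix.of_apply, Pi.star_apply, Complex.star_def,
      Finset.mul_sum]
    refine Finset.sum_congr rfl fun i _ => Finset.sum_congr rfl fun j _ => ?_
    ring
  simpa [hsum] using h

omit [DecidableEq n] in
/-- Real-part form: `0 ≤ Re Σ_{i,j} conj(g_i) g_j Tr[Q Y_i Y_jᴴ]` and the imaginary part vanishes.
[folklore] -/
theorem re_sum_sum_trace_mul_mul_conjTranspose_nonneg {Q : Matrix n n ℂ} (hQ : Q.PosSemidef)
    (Y : ι → Matrix n n ℂ) (g : ι → ℂ) :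
    0 ≤ (∑ i, ∑ j, (starRingEnd ℂ) (g i) * g j * (Q * Y i * (Y j)ᴴ).trace).re ∧
      (∑ i, ∑ j, (starRingEnd ℂ) (g i) * g j * (Q * Y i * (Y j)ᴴ).trace).im = 0 := by
  have h := sum_sum_trace_mul_mul_conjTranspose_nonneg hQ Y g
  rw [Complex.nonneg_iff] at h
  exact ⟨h.1, h.2.symm⟩

/-! ### Time reflection = adjoint of the ordered slice product -/

/-- For Hermitian slices `B_τ` the adjoint of the time-ordered product `B₀ B₁ ⋯ B_{m-1}` is the
time-REFLECTED product `B_{m-1} ⋯ B₁ B₀` (`Matrix.conjTranspose_list_prod`). [folklore] -/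
theorem conjTranspose_ofFn_prod_of_isHermitian {m : ℕ} (B : Fin m → Matrix n n ℂ)
    (hB : ∀ τ, (B τ).IsHermitian) :
    ((List.ofFn B).prod)ᴴ = (List.ofFn B).reverse.prod := by
  rw [conjTranspose_list_prod, List.map_ofFn]
  congr 2
  exact congrArg List.ofFn (funext fun τ => (hB τ).eq)

/-- **Reflection positivity in time of projected traces.** For `Q ≥ 0` (e.g. the sector
projection `P_S`, or `P_S A P_S` with `A ≥ 0` an observable on the reflection plane) and Hermitian
slice insertions `B_{i,τ}` (`i` a half-space configuration, `τ < m` the slices of the positive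
half; e.g. `B_{i,τ} = e^{-aH/2} K(θ_{i,τ}) e^{-aH/2}` with `K ≥ 0`), the `2m`-slice kernel
`W(i, j) = Tr[Q · (B_{i,0}⋯B_{i,m-1}) · (B_{j,m-1}⋯B_{j,0})]` (second half in time-reflected order)
is positive semidefinite. Osterwalder–Schrader (1973); Fröhlich–Israel–Lieb–Simon, CMP 62 (1978)
§2. [cite: FrohlichIsraelLiebSimon1978, §2 Theorem 2.1] -/
theorem posSemidef_timeReflectedTrace {Q : Matrix n n ℂ} (hQ : Q.PosSemidef) {m : ℕ}
    (B : ι → Fin m → Matrix n n ℂ) (hB : ∀ i τ, (B i τ).IsHermitian) :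
    (Matrix.of fun i j =>
      (Q * (List.ofFn (B i)).prod * (List.ofFn (B j)).reverse.prod).trace).PosSemidef := by
  have h := posSemidef_trace_mul_mul_conjTranspose hQ (fun i => (List.ofFn (B i)).prod)
  have hrev : ∀ j, ((List.ofFn (B j)).prod)ᴴ = (List.ofFn (B j)).reverse.prod :=
    fun j => conjTranspose_ofFn_prod_of_isHermitian (B j) (hB j)
  simpa only [hrev] using h

/-- Scalar form of time reflection positivity: for `Q ≥ 0`, Hermitian slices `B_{i,τ}` and
coefficients `g_i`, `0 ≤ Re Σ_{i,j} conj(g_i) g_j Tr[Q (B_{i,0}⋯B_{i,m-1}) (B_{j,m-1}⋯B_{j,0})]`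
(and the sum is real). Fröhlich–Israel–Lieb–Simon, CMP 62 (1978) §2.
[cite: FrohlichIsraelLiebSimon1978, §2 Theorem 2.1] -/
theorem re_sum_sum_timeReflectedTrace_nonneg {Q : Matrix n n ℂ} (hQ : Q.PosSemidef) {m : ℕ}
    (B : ι → Fin m → Matrix n n ℂ) (hB : ∀ i τ, (B i τ).IsHermitian) (g : ι → ℂ) :
    0 ≤ (∑ i, ∑ j, (starRingEnd ℂ) (g i) * g j *
        (Q * (List.ofFn (B i)).prod * (List.ofFn (B j)).reverse.prod).trace).re ∧
      (∑ i, ∑ j, (starRingEnd ℂ) (g i) * g j *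
        (Q * (List.ofFn (B i)).prod * (List.ofFn (B j)).reverse.prod).trace).im = 0 := by
  have h := re_sum_sum_trace_mul_mul_conjTranspose_nonneg hQ (fun i => (List.ofFn (B i)).prod) g
  have hrev : ∀ j, ((List.ofFn (B j)).prod)ᴴ = (List.ofFn (B j)).reverse.prod :=
    fun j => conjTranspose_ofFn_prod_of_isHermitian (B j) (hB j)
  simpa only [hrev] using h

/-! ### Positive transfer matrices have nonnegative projected partition functions -/

/-- **Projected partition functions of a positive transfer matrix are nonnegative**:
`0 ≤ Re Tr[Q 𝔹^M]` for `Q ≥ 0` (sector projection) and `𝔹 ≥ 0` (the slice-transfer matrix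
`Σ_θ B(θ)` / `∫ B(θ) dθ` of a time-reflection-positive phase marginal) and every `M` — no
partition-function zero in `M`. [folklore] -/
theorem re_trace_mul_pow_nonneg_of_posSemidef {Q T : Matrix n n ℂ} (hQ : Q.PosSemidef)
    (hT : T.PosSemidef) (M : ℕ) : 0 ≤ (Q * T ^ M).trace.re :=
  Literature.LinearAlgebra.Matrix.re_trace_mul_nonneg_of_posSemidef hQ (hT.pow M)

/-- The slice-transfer matrix of positive insertions is positive: `Σ_{θ ∈ s} B(θ) ≥ 0` for
`B(θ) ≥ 0` (`Matrix.posSemidef_sum`), whence `0 ≤ Re Tr[Q (Σ_θ B(θ))^M]`. [folklore] -/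
theorem re_trace_mul_sum_pow_nonneg {Q : Matrix n n ℂ} (hQ : Q.PosSemidef) {κ : Type*}
    (s : Finset κ) (B : κ → Matrix n n ℂ) (hB : ∀ θ ∈ s, (B θ).PosSemidef) (M : ℕ) :
    0 ≤ (Q * (∑ θ ∈ s, B θ) ^ M).trace.re :=
  re_trace_mul_pow_nonneg_of_posSemidef hQ (posSemidef_sum s hB) M

end Summit.HubbardSuperconductivity.HubbardSuperconductivity.Theorems
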